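import Summits.QuantumFields.BalabanUV.Beta.EriceRemainderEnclosureHistoryAutonomyComparisonDropBound

/-!
# EriceRemainderEnclosureHistoryAutonomyComparisonMarkovDamping — (E63g) THE MARKOV WEIGHT DAMPS THE LEVEL GAP: along box solutions `h′ ≤ h` from one pin of
# `B′ ≥ B` (isotone excess) and of a memory `B` whose increments dominate `L_0·(u_0 − u′_0)`, the level gap obeys the DAMPED recursion
# `δ_{l+1}·(1 + L_0·h′_{l+1}³∕2) ≤ δ_l + X_{l+1}`, `X_l = B′(S′h_l) − B(S h_l)` the STEP quantity at the deeper orbit pin — hence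
# `δ_n ≤ Σ_{m≤n} X_m·(1+p)^{−(n+1−m)}` whenever `L_0·h′_i³∕2 ≥ p` on the window: the first DAMPED form of (E63a)'s renewal inequality (its kernel `Θ` with the
# Markov part of the pin sensitivity only), for the renewal route (C″)∕(C⁗)

Cell `pub-balaban`, β-function sub-cell, BINDER row D4 «RemainderConst leaves for Bałaban's split» (`HOME/BINDER-OWNERS.md`; owner lineage `b2b-balaban-beta-an4`;
this file by co-owner #2 lineage `b2b-balaban-beta-d4-p2`, generation 56), β-FLOW TEAM duty (1), FREEZE (0) honoured (def-free; (E48a)'s `le_of_pin_le` ∕ `memFlow_tail`,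
node U2's `SeqBox` ∕ `MemFlow` BY NAME; nothing restated).  Seventh file of gen 56's station (E63); sequel of (E63a) `…ComparisonDropBound` §4 (`levelGap_le_sum_step`,
the undamped form) — see `HOME/b2b-balaban-beta-d4-p2/g56/STRATEGY-E58prime.md` §2.

HONEST FRAMING (page 1, verbatim and binding).  *"Discharging BetaPertH makes Bałaban's UV stability UNCONDITIONAL — a real constructive-QFT result; it is
NOT the continuum limit and NOT the Clay problem."*  THIS FILE DISCHARGES NOTHING OF THE KIND.  Elementary real analysis about ABSTRACT functionals on a box
]0,γ]^ℕ — hypotheses of a census, not facts; the form of Bałaban's (1.22) limit functional is NOT PRINTED ([I] p. 298; GAPS G-t4-U2-1∕-2) and NOT asserted.  Row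
D4 class UNCHANGED (critical-path width 0; instance 0∕1; D4 DISCHARGE NO DATE).  HONEST DEPENDENCY: continuum YM on T⁴ ⇐ BetaPertH ∧ nine spine estimates (0/9
proved); BetaPertH ⇐ (D1) ∧ (D4) ∧ CAP+tail; G-an2-4 gates asym, D1 and NE2/3/4.

THE POINT (census sense (α); the renewal route to (E58′)).  Exactly, `δ_{l+1} − δ_l = X_{l+1} − π_{l+1}` with `π_l = B′(S′h_l) − B′(S′h′_l) ≥ 0` the pin sensitivity
of the PERTURBED flow between the two pins `h′_l ≤ h_l`; (E63a) dropped `π`.  The excess part of `π` is nonnegative (isotone excess, `S′` monotone in the pin) and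
the `B`-part is at least the Markov share: `B(S′h_l) − B(S′h′_l) ≥ L_0·(h_l − h′_l)` when the increments of `B` dominate `L_0·(u_0 − u′_0)` (the affine memory
`b + Σ_k L_k u_k` with equality plus nonnegative terms); and a coupling gap is at least the PERTURBED weight times the level gap, `h_l − h′_l ≥ (h′_l³∕2)·δ_l` (§1
`cube_mul_levelGap_le_gap`).  So `δ_{l+1}(1 + L_0 h′_{l+1}³∕2) ≤ δ_l + X_{l+1}` (§2 `levelGap_succ_damped`) and, under `L_0 h′_i³∕2 ≥ p ≥ 0` for `1 ≤ i ≤ n`,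
`δ_n ≤ Σ_{m<n} X_{m+1}·(1+p)^{−(n−m)}` (§2 `levelGap_le_sum_step_damped`; `p = 0` is (E63a)).  NOT CLAIMED: damping from the ages `k ≥ 1` (the damping lemma
(A″) proper); any class theorem; anything printed.

WHAT IS PROVED ([folklore]; 0 `def`, 0 sorry).  §1 **`cube_mul_levelGap_le_gap`**.  §2 **`levelGap_succ_damped`**, **`levelGap_le_sum_step_damped`**.
-/
noncomputable section
open Finset Set

namespace Summit.QuantumFields.BalabanUV.Beta.EriceRemainderEnclosureHistoryAutonomyComparisonMarkovDamping

open Literature.MathematicalPhysics.QuantumFieldTheory.Balaban1983to89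
open Literature.MathematicalPhysics.QuantumFieldTheory.Balaban1983to89.T4BetaStationary
open Literature.MathematicalPhysics.QuantumFieldTheory.Balaban1983to89.T4BetaFlowWellPosed
open Summit.QuantumFields.BalabanUV.Beta.EriceRemainderEnclosureHistoryAutonomyOrder (le_of_pin_le memFlow_tail)

variable {B B' : (ℕ → ℝ) → ℝ} {M' γ b y : ℝ} {L : ℕ → ℝ} {h h' : ℕ → ℝ} {S S' : ℝ → ℕ → ℝ}

/-! ## §1 A coupling gap is at least the perturbed weight times the level gap -/

/-- **THE COUPLING GAP FROM BELOW**: `0 < x′ ≤ x` ⟹ `(x′³∕2)·(1∕x′² − 1∕x²) ≤ x − x′` (the secant of `a ↦ a^{−1∕2}` between the two levels is at least its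
derivative at the higher level). [folklore] -/
theorem cube_mul_levelGap_le_gap {x x' : ℝ} (hx' : 0 < x') (hle : x' ≤ x) : x' ^ 3 / 2 * (1 / x' ^ 2 - 1 / x ^ 2) ≤ x - x' := by
  have hx : 0 < x := hx'.trans_le hle
  have e : x' ^ 3 / 2 * (1 / x' ^ 2 - 1 / x ^ 2) = (x - x') * (x' * (x + x') / (2 * x ^ 2)) := by
    field_simp; ring
  rw [e]
  have hfac : x' * (x + x') / (2 * x ^ 2) ≤ 1 := by
    rw [div_le_one (by positivity)]; nlinarith
  have hgap : 0 ≤ x - x' := by linarith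
  calc (x - x') * (x' * (x + x') / (2 * x ^ 2)) ≤ (x - x') * 1 := mul_le_mul_of_nonneg_left hfac hgap
    _ = x - x' := mul_one _

/-! ## §2 The damped recursion of the level gap and its resolvent -/

/-- **THE MARKOV WEIGHT DAMPS THE LEVEL GAP, one step.**  `B` with increments dominating the Markov share (`L_0·(u_0 − u′_0) ≤ B u − B u′` for box histories
`u′ ≤ u`, `L_0 ≥ 0`); the excess `B′ − B` ISOTONE on the box, `B′` with zeroth moment and floor (for pin monotonicity); unique solution families `S`, `S′`; `h`,
`h′` box solutions of `B`, `B′` from one pin `y` with `h′ ≤ h`.  Then for every `l`: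
`(1∕h′_{l+1}² − 1∕h_{l+1}²)·(1 + L_0·h′_{l+1}³∕2) ≤ (1∕h′_l² − 1∕h_l²) + (B′(S′ h_{l+1}) − B(S h_{l+1}))`. [folklore] -/
theorem levelGap_succ_damped {b' : ℝ} (hL0 : 0 ≤ L 0)
    (hdomdiff : ∀ u u' : ℕ → ℝ, SeqBox γ u → SeqBox γ u' → (∀ j, u' j ≤ u j) → L 0 * (u 0 - u' 0) ≤ B u - B u')
    (hDmono : ∀ u v : ℕ → ℝ, SeqBox γ u → SeqBox γ v → (∀ j, u j ≤ v j) → B' u - B u ≤ B' v - B v) (hb' : 0 < b')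
    (hB' : ∀ u u' : ℕ → ℝ, SeqBox γ u → SeqBox γ u' → ∀ D : ℝ, (∀ j, |u j - u' j| ≤ D) → |B' u - B' u'| ≤ M' * D) (hM' : 0 ≤ M')
    (hlo' : ∀ u, SeqBox γ u → b' ≤ B' u)
    (hS : ∀ p, 0 < p → p ≤ γ → SeqBox γ (S p) ∧ MemFlow B p (S p))
    (huniq : ∀ p, 0 < p → p ≤ γ → ∀ u u' : ℕ → ℝ, SeqBox γ u → SeqBox γ u' → MemFlow B p u → MemFlow B p u' → u = u')
    (hS' : ∀ p, 0 < p → p ≤ γ → SeqBox γ (S' p) ∧ MemFlow B' p (S' p))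
    (huniq' : ∀ p, 0 < p → p ≤ γ → ∀ u u' : ℕ → ℝ, SeqBox γ u → SeqBox γ u' → MemFlow B' p u → MemFlow B' p u' → u = u')
    (hh : SeqBox γ h) (hf : MemFlow B y h) (hh' : SeqBox γ h') (hf' : MemFlow B' y h') (hle : ∀ j, h' j ≤ h j) (l : ℕ) :
    (1 / h' (l + 1) ^ 2 - 1 / h (l + 1) ^ 2) * (1 + L 0 * (h' (l + 1) ^ 3 / 2))
      ≤ (1 / h' l ^ 2 - 1 / h l ^ 2) + (B' (S' (h (l + 1))) - B (S (h (l + 1)))) := by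
  have hm := hh (l + 1)
  have hm' := hh' (l + 1)
  -- the tails are the family members from the deeper pins
  have et : (fun j => h (l + 1 + j)) = S (h (l + 1)) :=
    huniq _ hm.1 hm.2 _ _ (seqBox_shift hh (l + 1)) (hS _ hm.1 hm.2).1 (memFlow_tail hf (l + 1)) (hS _ hm.1 hm.2).2
  have et' : (fun j => h' (l + 1 + j)) = S' (h' (l + 1)) :=
    huniq' _ hm'.1 hm'.2 _ _ (seqBox_shift hh' (l + 1)) (hS' _ hm'.1 hm'.2).1 (memFlow_tail hf' (l + 1)) (hS' _ hm'.1 hm'.2).2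
  have hkS := hS' _ hm.1 hm.2
  have hkS' := hS' _ hm'.1 hm'.2
  -- S′ is monotone in the pin: S′(h′_{l+1}) ≤ S′(h_{l+1})
  have hpin : ∀ j, S' (h' (l + 1)) j ≤ S' (h (l + 1)) j := fun j =>
    le_of_pin_le hb' hB' hM' hlo' huniq' hm'.1 (hle (l + 1)) hm.2 hkS'.1 hkS.1 hkS'.2 hkS.2 j
  -- the pin sensitivity of the perturbed flow: π ≥ L_0 (h_{l+1} − h′_{l+1}) ≥ L_0 (h′³/2) δ_{l+1}
  have hπ : L 0 * (h (l + 1) - h' (l + 1)) ≤ B' (S' (h (l + 1))) - B' (S' (h' (l + 1))) := by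
    have h1 := hdomdiff (S' (h (l + 1))) (S' (h' (l + 1))) hkS.1 hkS'.1 hpin
    have h2 := hDmono _ _ hkS'.1 hkS.1 hpin
    rw [hkS.2.1, hkS'.2.1] at h1
    linarith
  have hg : h' (l + 1) ^ 3 / 2 * (1 / h' (l + 1) ^ 2 - 1 / h (l + 1) ^ 2) ≤ h (l + 1) - h' (l + 1) :=
    cube_mul_levelGap_le_gap hm'.1 (hle (l + 1))
  have hπ' : L 0 * (h' (l + 1) ^ 3 / 2) * (1 / h' (l + 1) ^ 2 - 1 / h (l + 1) ^ 2) ≤ B' (S' (h (l + 1))) - B' (S' (h' (l + 1))) := by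
    calc L 0 * (h' (l + 1) ^ 3 / 2) * (1 / h' (l + 1) ^ 2 - 1 / h (l + 1) ^ 2)
        = L 0 * (h' (l + 1) ^ 3 / 2 * (1 / h' (l + 1) ^ 2 - 1 / h (l + 1) ^ 2)) := by ring
      _ ≤ L 0 * (h (l + 1) - h' (l + 1)) := mul_le_mul_of_nonneg_left hg hL0
      _ ≤ _ := hπ
  -- the increment identity: δ_{l+1} − δ_l = B′(h′_{l+1+·}) − B(h_{l+1+·}) = B′(S′ h′_{l+1}) − B(S h_{l+1})
  have e1 := hf.2 l
  have e2 := hf'.2 l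
  have eB : B (fun j => h (l + 1 + j)) = B (S (h (l + 1))) := by rw [et]
  have eB' : B' (fun j => h' (l + 1 + j)) = B' (S' (h' (l + 1))) := by rw [et']
  nlinarith [hπ', e1, e2, eB, eB']

/-- **THE DAMPED LEVEL-GAP BOUND.**  Under the hypotheses of `levelGap_succ_damped`, if `p ≥ 0` with `p ≤ L_0·h′_i³∕2` for `1 ≤ i ≤ n` (the Markov damping on the
window), then `1∕h′_n² − 1∕h_n² ≤ Σ_{m<n} (B′(S′ h_{m+1}) − B(S h_{m+1}))·(1+p)^{−(n−m)}` — (E63a) `levelGap_le_sum_step` is `p = 0`; the STEP quantities enter with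
GEOMETRIC weights. [folklore] -/
theorem levelGap_le_sum_step_damped {b' p : ℝ} (hL0 : 0 ≤ L 0)
    (hdomdiff : ∀ u u' : ℕ → ℝ, SeqBox γ u → SeqBox γ u' → (∀ j, u' j ≤ u j) → L 0 * (u 0 - u' 0) ≤ B u - B u')
    (hDmono : ∀ u v : ℕ → ℝ, SeqBox γ u → SeqBox γ v → (∀ j, u j ≤ v j) → B' u - B u ≤ B' v - B v) (hb' : 0 < b')
    (hB' : ∀ u u' : ℕ → ℝ, SeqBox γ u → SeqBox γ u' → ∀ D : ℝ, (∀ j, |u j - u' j| ≤ D) → |B' u - B' u'| ≤ M' * D) (hM' : 0 ≤ M')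
    (hlo' : ∀ u, SeqBox γ u → b' ≤ B' u)
    (hS : ∀ p, 0 < p → p ≤ γ → SeqBox γ (S p) ∧ MemFlow B p (S p))
    (huniq : ∀ p, 0 < p → p ≤ γ → ∀ u u' : ℕ → ℝ, SeqBox γ u → SeqBox γ u' → MemFlow B p u → MemFlow B p u' → u = u')
    (hS' : ∀ p, 0 < p → p ≤ γ → SeqBox γ (S' p) ∧ MemFlow B' p (S' p))
    (huniq' : ∀ p, 0 < p → p ≤ γ → ∀ u u' : ℕ → ℝ, SeqBox γ u → SeqBox γ u' → MemFlow B' p u → MemFlow B' p u' → u = u')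
    (hh : SeqBox γ h) (hf : MemFlow B y h) (hh' : SeqBox γ h') (hf' : MemFlow B' y h') (hle : ∀ j, h' j ≤ h j)
    (hp0 : 0 ≤ p) (n : ℕ) (hp : ∀ i, 1 ≤ i → i ≤ n → p ≤ L 0 * (h' i ^ 3 / 2)) :
    1 / h' n ^ 2 - 1 / h n ^ 2 ≤ ∑ m ∈ range n, (B' (S' (h (m + 1))) - B (S (h (m + 1)))) * (1 + p)⁻¹ ^ (n - m) := by
  induction n with
  | zero => rw [hf.1, hf'.1]; simp
  | succ n ih =>
    have hp' : ∀ i, 1 ≤ i → i ≤ n → p ≤ L 0 * (h' i ^ 3 / 2) := fun i hi hin => hp i hi (Nat.le_succ_of_le hin)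
    have ihn := ih hp'
    have hstep := levelGap_succ_damped hL0 hdomdiff hDmono hb' hB' hM' hlo' hS huniq hS' huniq' hh hf hh' hf' hle n
    have hpn : p ≤ L 0 * (h' (n + 1) ^ 3 / 2) := hp (n + 1) (Nat.succ_pos n) le_rfl
    have hδ0 : 0 ≤ 1 / h' (n + 1) ^ 2 - 1 / h (n + 1) ^ 2 :=
      sub_nonneg.mpr (one_div_le_one_div_of_le (pow_pos (hh' (n + 1)).1 2) (pow_le_pow_left₀ (hh' (n + 1)).1.le (hle (n + 1)) 2))
    have h1p : 0 < 1 + p := by linarith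
    -- δ_{n+1}(1+p) ≤ δ_n + X_{n+1}
    have hmain : (1 / h' (n + 1) ^ 2 - 1 / h (n + 1) ^ 2) * (1 + p) ≤ (1 / h' n ^ 2 - 1 / h n ^ 2) + (B' (S' (h (n + 1))) - B (S (h (n + 1)))) :=
      le_trans (mul_le_mul_of_nonneg_left (by linarith) hδ0) hstep
    have hdiv : 1 / h' (n + 1) ^ 2 - 1 / h (n + 1) ^ 2
        ≤ ((1 / h' n ^ 2 - 1 / h n ^ 2) + (B' (S' (h (n + 1))) - B (S (h (n + 1))))) * (1 + p)⁻¹ := by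
      rw [le_mul_inv_iff₀ h1p]; exact hmain
    refine hdiv.trans ?_
    rw [sum_range_succ, add_mul]
    have hsum : (1 / h' n ^ 2 - 1 / h n ^ 2) * (1 + p)⁻¹
        ≤ ∑ m ∈ range n, (B' (S' (h (m + 1))) - B (S (h (m + 1)))) * (1 + p)⁻¹ ^ (n + 1 - m) := by
      calc (1 / h' n ^ 2 - 1 / h n ^ 2) * (1 + p)⁻¹
          ≤ (∑ m ∈ range n, (B' (S' (h (m + 1))) - B (S (h (m + 1)))) * (1 + p)⁻¹ ^ (n - m)) * (1 + p)⁻¹ :=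
            mul_le_mul_of_nonneg_right ihn (inv_nonneg.mpr h1p.le)
        _ = ∑ m ∈ range n, (B' (S' (h (m + 1))) - B (S (h (m + 1)))) * (1 + p)⁻¹ ^ (n + 1 - m) := by
            rw [sum_mul]
            refine sum_congr rfl fun m hm => ?_
            have hmn : m < n := mem_range.mp hm
            rw [show n + 1 - m = (n - m) + 1 by omega, pow_succ]; ring
    have hlast : (B' (S' (h (n + 1))) - B (S (h (n + 1)))) * (1 + p)⁻¹ ≤ (B' (S' (h (n + 1))) - B (S (h (n + 1)))) * (1 + p)⁻¹ ^ (n + 1 - n) := by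
      rw [show n + 1 - n = 1 by omega, pow_one]
    linarith

end Summit.QuantumFields.BalabanUV.Beta.EriceRemainderEnclosureHistoryAutonomyComparisonMarkovDamping

end
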